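import Mathlib.Order.Interval.Set.Pi
import Mathlib.Data.Real.Basic
import Mathlib.Data.Fin.VecNotation
import Mathlib.Tactic.Linarith
import Mathlib.Tactic.FinCases
import Literature.Analysis.ValidatedNumerics.BoxCover
import HarnessLib

/-!
# A delivered box inside an ARBITRARY finite union of certified cells: kd-tree certificates
# (cell-containment leaves for `KdCert`), with the honest uncovered remainder as tagged cells

Topic `Literature/Computation/Certificates` (companion of `BoxCoveringByCells.lean`, whose module
docstring names exactly this as not done there: "any claim that a covering by NON-grid cells can be
checked (refine to a grid instead)"). Written for the Hubbard material oracle, stage S2 "points →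
boxes" (D-0096/D-0097): a downfolded parameter box `Set.Icc lo hi ⊆ (Fin d → ℝ)` (coordinates
`(U/t, t'/t, n)`, rational corners — `Summit…Downfold.S2Seam.s2Lo/s2Hi`) must receive ONE word from
cells certified one by one by DIFFERENT producers on DIFFERENT grids (point-anchored rectangles,
`2 × 2` tilings, half-`t'` cells, thermal cells, …), so the union is not a product grid and the
inclusion `box ⊆ ⋃ cells` has to be CHECKED, not assumed. Everything here is PROVED; no named fact,
no number, no physics.

The device is the tree's own kd-tree certificate `Literature.Analysis.ValidatedNumerics.KdCert`
(`BoxCover.lean`: rational boxes `Box = List (ℚ × ℚ)` with real points `Box.mem`, a kernel-evaluable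
checker `KdCert.check leafOK` walking a tree of coordinate bisections, and `KdCert.sound`) with a NEW
LEAF CHECK: the leaf box is (empty or) coordinatewise inside a named cell. A regular subpaving
represented by a binary tree with an inclusion test at the leaves is the standard data structure of
set-membership interval analysis (Jaulin–Kieffer–Didrit–Walter 2001, ch. 3); the soundness half
("the sub-boxes' union is the box", Moore 1966 §4.4, Neumaier 2004 §12 eq. (12.2)) is all that is
used, and it holds WHATEVER the cut values are (cuts belong inside the current box: `Box.split` at a
cut beyond an end gives one EMPTY child — accepted by the emptiness test — and one child LARGER than
the box, which must then itself be covered; sound, never useful).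

* §1 `subBox B C` (coordinatewise `C.lo ≤ B.lo`, `B.hi ≤ C.hi` on the stored range), `isEmptyBox B`
  (some stored interval has `hi < lo`), the leaf check `cellLeaf cell B j := isEmptyBox B || subBox B
  (cell j)` and their soundness (`mem_of_subBox`, `not_mem_of_isEmptyBox`, `cellLeaf_sound`);
  `exists_mem_cell_of_kdCheck`: an accepted tree puts every real point of the root box in some cell.
* §2 THE S2 SHAPE: corner vectors `lo hi : Fin d → ℚ`, the box `boxOfFn lo hi : Box`, the zero
  extension `zeroExtend θ` of `θ : Fin d → ℝ`, and `mem_boxOfFn_zeroExtend_iff`: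
  `(boxOfFn lo hi).mem (zeroExtend θ) ↔ θ ∈ Set.Icc (lo cast to ℝ) (hi cast to ℝ)`.
* §3 BOX WORDS: cells `L H : ι → Fin d → ℚ` (any index type; the tree's leaves carry indices),
  `exists_mem_Icc_of_kdCheck` (every point of the delivered box lies in some cell),
  `Icc_subset_iUnion_of_kdCheck`, `forall_mem_Icc_of_kdCheck` (a word proved on every cell holds on
  the box), `…_of_le / _of_ge` (certified constants: floors / ceilings), `mem_Icc_of_kdCheck_window`,
  and the HONEST-REMAINDER form `forall_mem_Icc_or_gap_of_kdCheck`: cells carry a tag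
  `certified : ι → Bool`, the uncertified ones are declared GAPS ("undetermined — box not covered",
  the router's wording); at every point of the box `W θ ∨ θ ∈ some gap cell` (a finite list).
* §4 SCALAR LETTERS for the `t–t'` consumers: `forall₂_of_kdCheck` (`(s, U)` rectangles) and
  `forall₃_of_kdCheck` (`(U, t', n)` boxes, the order of `HubbardTTPrimeBoxWordCovering` §3/§4 and of
  `S2Seam`), hypotheses and conclusions in scalar inequalities with `((q : ℚ) : ℝ)` corners.

How a certificate is produced and checked. The router (or a box engineer) bisects the delivered box
until every leaf lies in one atlas cell (or in a declared gap), prints the tree as a term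
`KdCert.split 0 (8 : ℚ) (.split 1 (-1/4) (.leaf 0) (.leaf 1)) (.leaf 2)` (axis `0 = U/t`, `1 = t'/t`,
`2 = n`), and the hypothesis `t.check (cellLeaf …) (boxOfFn lo hi) = true` is discharged by
`decide +kernel` (the idiom of `BoxCover.lean`; cost = number of leaves × `3d` rational comparisons;
checked on a 3-D example with cells `![![…], …]`: accepted / empty-child / wrong-leaf trees evaluate to
`true` / `true` / `false`). The per-cell hypotheses then read `((L j k : ℚ) : ℝ) ≤ …`; with literal
tables `L H := ![![7, -3/10, 17/20], …]` they are put in the cell producers' letters by `fin_cases j`,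
`simp only [L, H, Fin.isValue, Matrix.cons_val]` (the `![…]` evaluation simproc, by name),
`push_cast`, `linarith` — NOT `norm_num [L, H]`, which trips the simproc on normalised entries.
Completeness is not claimed or needed, but holds in the obvious sense: if the box IS inside the union,
cutting at all the cells' corner coordinates inside the box produces an accepted tree.

What is NOT here: how a cell word is produced; product grids (`BoxCoveringByCells` §2–§3 need no
certificate — two inequalities per coordinate); anything about the Hubbard model.

## Tree search (nearest existing declarations, reused not restated)

`Literature.Analysis.ValidatedNumerics.KdCert.check / .sound`, `Box.mem`, `Box.split`, `Box.ivl`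
(`BoxCover.lean`; leaf checks there and in `BoxInfeasibility`, `RBoxInfeasibility`, `IntervalFunctions`
are interval-EVALUATION tests, none is containment in a given cell); `…Zhang2022.RepairCoverFrame`
(`coverCheck`: lists of root boxes, region-relative soundness; `Box_mem_of_forall`);
`…QuantumFieldTheory.OPESpaceCoverCertificate.CoverTree.Certifies` (a `Prop`-level real-cut twin with
an abstract leaf test); `BoxCovering.forall_of_forall_cells` (composition GIVEN the cover) and
`ThermodynamicLimit.energyDensityTT'_mem_Icc_of_cover` (idem, energy windows). `lean search
'subBox|isEmptyBox|cellLeaf|boxOfFn|zeroExtend'`: no prior declaration.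

## References

* R. E. Moore, *Interval Analysis*, Prentice-Hall 1966, §4.4 (refinement by subdivision: the
  sub-boxes cover the box). [cite: Moore1966, §4.4]
* L. Jaulin, M. Kieffer, O. Didrit, É. Walter, *Applied Interval Analysis*, Springer 2001, ch. 3
  (subpavings: finite unions of boxes stored as binary trees of bisections; inclusion tests at the
  leaves). [cite: JaulinKiefferDidritWalter2001, ch. 3]
* A. Neumaier, *Complete search in continuous global optimization and constraint satisfaction*, Acta
  Numerica 13 (2004), §12 eq. (12.2)–(12.3). [cite: Neumaier2004CompleteSearch, §12]
-/

namespace Literature.Computation.Certificates.BoxCovering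

open Set
open Literature.Analysis.ValidatedNumerics (Box KdCert)
open Literature.Analysis.ValidatedNumerics

/-! ### §1 The cell-containment leaf check and its soundness -/

/-- `subBox B C`: on every stored coordinate (`i < max |B| |C|`) the interval of `B` lies inside the
interval of `C` (`C.lo ≤ B.lo` and `B.hi ≤ C.hi`); beyond both lists both intervals are the junk
`[0, 0]` of `Box.mem`, so nothing needs checking there. [cite: JaulinKiefferDidritWalter2001, ch. 3] -/
def subBox (B C : Box) : Bool :=
  (List.range (max B.length C.length)).all fun i =>
    decide ((C.ivl i).1 ≤ (B.ivl i).1) && decide ((B.ivl i).2 ≤ (C.ivl i).2)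

/-- `isEmptyBox B`: some stored coordinate interval of `B` is empty (`hi < lo`), so no real point
lies in `B` (a leaf with an empty box is accepted). [cite: JaulinKiefferDidritWalter2001, ch. 3] -/
def isEmptyBox (B : Box) : Bool :=
  (List.range B.length).any fun i => decide ((B.ivl i).2 < (B.ivl i).1)

/-- **The leaf check of a box-cover certificate**: the leaf box is empty, or inside the cell named by
the leaf. [cite: JaulinKiefferDidritWalter2001, ch. 3] -/
def cellLeaf {ι : Type} (cell : ι → Box) (B : Box) (j : ι) : Bool :=
  isEmptyBox B || subBox B (cell j)

/-- Beyond the end of the list a box's coordinate interval is the junk `[0, 0]`. [folklore] -/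
private theorem ivl_of_length_le {B : Box} {i : ℕ} (h : B.length ≤ i) : B.ivl i = (0, 0) := by
  unfold Box.ivl
  rw [List.getD_eq_getElem?_getD, List.getElem?_eq_none h]
  rfl

/-- **Soundness of `subBox`**: every real point of `B` is a point of `C`.
[cite: JaulinKiefferDidritWalter2001, ch. 3] -/
theorem mem_of_subBox {B C : Box} (h : subBox B C = true) {x : ℕ → ℝ} (hx : B.mem x) : C.mem x := by
  intro i
  by_cases hi : i < max B.length C.length
  · have hall := List.all_eq_true.1 h i (List.mem_range.2 hi)
    rw [Bool.and_eq_true, decide_eq_true_eq, decide_eq_true_eq] at hall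
    have h1 : ((C.ivl i).1 : ℝ) ≤ ((B.ivl i).1 : ℝ) := by exact_mod_cast hall.1
    have h2 : ((B.ivl i).2 : ℝ) ≤ ((C.ivl i).2 : ℝ) := by exact_mod_cast hall.2
    exact ⟨h1.trans (hx i).1, (hx i).2.trans h2⟩
  · have hB : B.ivl i = (0, 0) := ivl_of_length_le (by omega)
    have hC : C.ivl i = (0, 0) := ivl_of_length_le (by omega)
    rw [hC, ← hB]
    exact hx i

/-- **Soundness of `isEmptyBox`**: an empty box has no real point.
[cite: JaulinKiefferDidritWalter2001, ch. 3] -/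
theorem not_mem_of_isEmptyBox {B : Box} (h : isEmptyBox B = true) (x : ℕ → ℝ) : ¬ B.mem x := by
  intro hx
  obtain ⟨i, -, hi⟩ := List.any_eq_true.1 h
  have hlt : ((B.ivl i).2 : ℝ) < ((B.ivl i).1 : ℝ) := by exact_mod_cast of_decide_eq_true hi
  linarith [(hx i).1, (hx i).2]

/-- **Soundness of the leaf check**: every real point of an accepted leaf box lies in the named cell.
[cite: JaulinKiefferDidritWalter2001, ch. 3] -/
theorem cellLeaf_sound {ι : Type} (cell : ι → Box) :
    ∀ (B : Box) (j : ι), cellLeaf cell B j = true → ∀ x, B.mem x → (cell j).mem x := by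
  intro B j h x hx
  rw [cellLeaf, Bool.or_eq_true] at h
  rcases h with h | h
  · exact absurd hx (not_mem_of_isEmptyBox h x)
  · exact mem_of_subBox h hx

/-- **Coverage from an accepted kd-tree** (`Box` form): if the tree `t`, checked with the
cell-containment leaf test against the root box, is accepted, every real point of the root box lies
in some cell — namely the cell named by the leaf the point falls into; the cut values are arbitrary.
[cite: Moore1966, §4.4] -/
theorem exists_mem_cell_of_kdCheck {ι : Type} (cell : ι → Box) {root : Box} {t : KdCert ι}
    (h : t.check (cellLeaf cell) root = true) : ∀ x, root.mem x → ∃ j, (cell j).mem x :=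
  KdCert.sound (P := fun x => ∃ j, (cell j).mem x)
    (fun B j hB x hx => ⟨j, cellLeaf_sound cell B j hB x hx⟩) t root h

/-! ### §2 The S2 shape: corner vectors `Fin d → ℚ`, real points `Fin d → ℝ` -/

/-- The rational box with corner vectors `lo hi : Fin d → ℚ`, as a `Box` (coordinate `k` ranges over
`[lo k, hi k]`). [folklore] -/
def boxOfFn {d : ℕ} (lo hi : Fin d → ℚ) : Box := List.ofFn fun k => (lo k, hi k)

/-- The zero extension of a point `θ : Fin d → ℝ` to all of `ℕ` (the `[0, 0]` convention of
`Box.mem` beyond the stored coordinates). [folklore] -/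
def zeroExtend {d : ℕ} (θ : Fin d → ℝ) (i : ℕ) : ℝ := if h : i < d then θ ⟨i, h⟩ else 0

/-- `boxOfFn` stores `d` coordinates. [folklore] -/
@[simp] private theorem length_boxOfFn {d : ℕ} (lo hi : Fin d → ℚ) : (boxOfFn lo hi).length = d := by
  simp [boxOfFn]

/-- The stored coordinate intervals of `boxOfFn`. [folklore] -/
private theorem ivl_boxOfFn {d : ℕ} (lo hi : Fin d → ℚ) {i : ℕ} (h : i < d) :
    (boxOfFn lo hi).ivl i = (lo ⟨i, h⟩, hi ⟨i, h⟩) := by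
  unfold Box.ivl boxOfFn
  have hl : i < (List.ofFn fun k : Fin d => (lo k, hi k)).length := by simpa using h
  rw [List.getD_eq_getElem?_getD, List.getElem?_eq_getElem hl, Option.getD_some, List.getElem_ofFn]

/-- `zeroExtend` on a stored coordinate. [folklore] -/
@[simp] private theorem zeroExtend_of_lt {d : ℕ} (θ : Fin d → ℝ) {i : ℕ} (h : i < d) :
    zeroExtend θ i = θ ⟨i, h⟩ := by
  simp [zeroExtend, h]

/-- `zeroExtend` beyond the stored coordinates. [folklore] -/
@[simp] private theorem zeroExtend_of_le {d : ℕ} (θ : Fin d → ℝ) {i : ℕ} (h : d ≤ i) :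
    zeroExtend θ i = 0 := by
  simp [zeroExtend, not_lt.2 h]

/-- `zeroExtend` at a `Fin d` index. [folklore] -/
@[simp] private theorem zeroExtend_val {d : ℕ} (θ : Fin d → ℝ) (k : Fin d) : zeroExtend θ k = θ k := by
  simp [zeroExtend, k.isLt]

/-- **The two box languages agree**: the zero extension of `θ` lies in `boxOfFn lo hi` iff `θ` lies in
the delivered box `Set.Icc lo hi` (corners cast to `ℝ`) — a point lies in an interval vector (box) iff
each coordinate lies in its interval. [cite: JaulinKiefferDidritWalter2001, ch. 2] -/
theorem mem_boxOfFn_zeroExtend_iff {d : ℕ} (lo hi : Fin d → ℚ) (θ : Fin d → ℝ) :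
    (boxOfFn lo hi).mem (zeroExtend θ) ↔
      θ ∈ Set.Icc (fun k => ((lo k : ℚ) : ℝ)) (fun k => ((hi k : ℚ) : ℝ)) := by
  constructor
  · intro h
    refine ⟨fun k => ?_, fun k => ?_⟩
    · have hk := h k
      rw [ivl_boxOfFn lo hi k.isLt, zeroExtend_val] at hk
      exact hk.1
    · have hk := h k
      rw [ivl_boxOfFn lo hi k.isLt, zeroExtend_val] at hk
      exact hk.2
  · rintro ⟨h₁, h₂⟩ i
    by_cases hlt : i < d
    · rw [ivl_boxOfFn lo hi hlt, zeroExtend_of_lt θ hlt]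
      exact ⟨h₁ ⟨i, hlt⟩, h₂ ⟨i, hlt⟩⟩
    · have hle : d ≤ i := not_lt.1 hlt
      have hivl : (boxOfFn lo hi).ivl i = (0, 0) := ivl_of_length_le (by simpa using hle)
      rw [hivl, zeroExtend_of_le θ hle]
      simp

/-! ### §3 Box words from an accepted certificate -/

/-- **Every point of the delivered box lies in some cell** (S2 shape). Cells `[L j, H j]`, `j : ι`, a
delivered box `[lo, hi]` (all corners rational vectors `Fin d → ℚ`), and a kd-tree `t` whose leaves
carry cell indices: if `t.check (cellLeaf fun j => boxOfFn (L j) (H j)) (boxOfFn lo hi) = true`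
(discharged by `decide +kernel`), then every real `θ ∈ Set.Icc lo hi` lies in some `Set.Icc (L j) (H j)`.
[cite: Moore1966, §4.4] -/
theorem exists_mem_Icc_of_kdCheck {d : ℕ} {ι : Type} (L H : ι → Fin d → ℚ) {lo hi : Fin d → ℚ}
    {t : KdCert ι}
    (h : t.check (cellLeaf fun j => boxOfFn (L j) (H j)) (boxOfFn lo hi) = true) :
    ∀ θ ∈ Set.Icc (fun k => ((lo k : ℚ) : ℝ)) (fun k => ((hi k : ℚ) : ℝ)),
      ∃ j, θ ∈ Set.Icc (fun k => ((L j k : ℚ) : ℝ)) (fun k => ((H j k : ℚ) : ℝ)) := by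
  intro θ hθ
  obtain ⟨j, hj⟩ := exists_mem_cell_of_kdCheck (fun j => boxOfFn (L j) (H j)) h (zeroExtend θ)
    ((mem_boxOfFn_zeroExtend_iff lo hi θ).2 hθ)
  exact ⟨j, (mem_boxOfFn_zeroExtend_iff (L j) (H j) θ).1 hj⟩

/-- The same as a set inclusion: the delivered box lies in the union of the cells.
[cite: Moore1966, §4.4] -/
theorem Icc_subset_iUnion_of_kdCheck {d : ℕ} {ι : Type} (L H : ι → Fin d → ℚ) {lo hi : Fin d → ℚ}
    {t : KdCert ι}
    (h : t.check (cellLeaf fun j => boxOfFn (L j) (H j)) (boxOfFn lo hi) = true) :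
    Set.Icc (fun k => ((lo k : ℚ) : ℝ)) (fun k => ((hi k : ℚ) : ℝ)) ⊆
      ⋃ j, Set.Icc (fun k => ((L j k : ℚ) : ℝ)) (fun k => ((H j k : ℚ) : ℝ)) := by
  intro θ hθ
  obtain ⟨j, hj⟩ := exists_mem_Icc_of_kdCheck L H h θ hθ
  exact Set.mem_iUnion.2 ⟨j, hj⟩

/-- **Box word from cell words.** If a word `W` holds at every point of every cell and the
certificate is accepted, `W` holds at every point of the delivered box.
[cite: Neumaier2004CompleteSearch, §12] -/
theorem forall_mem_Icc_of_kdCheck {d : ℕ} {ι : Type} (L H : ι → Fin d → ℚ) {lo hi : Fin d → ℚ}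
    {t : KdCert ι}
    (h : t.check (cellLeaf fun j => boxOfFn (L j) (H j)) (boxOfFn lo hi) = true)
    {W : (Fin d → ℝ) → Prop}
    (hW : ∀ j, ∀ θ ∈ Set.Icc (fun k => ((L j k : ℚ) : ℝ)) (fun k => ((H j k : ℚ) : ℝ)), W θ) :
    ∀ θ ∈ Set.Icc (fun k => ((lo k : ℚ) : ℝ)) (fun k => ((hi k : ℚ) : ℝ)), W θ := by
  intro θ hθ
  obtain ⟨j, hj⟩ := exists_mem_Icc_of_kdCheck L H h θ hθ
  exact hW j θ hj

/-- **Cell-dependent words**: every point of the delivered box lies in a cell whose own word it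
satisfies (the form to use when the cells carry different statements, e.g. windows with different
end points, or tags). [cite: Neumaier2004CompleteSearch, §12] -/
theorem exists_mem_Icc_and_of_kdCheck {d : ℕ} {ι : Type} (L H : ι → Fin d → ℚ) {lo hi : Fin d → ℚ}
    {t : KdCert ι}
    (h : t.check (cellLeaf fun j => boxOfFn (L j) (H j)) (boxOfFn lo hi) = true)
    {W : ι → (Fin d → ℝ) → Prop}
    (hW : ∀ j, ∀ θ ∈ Set.Icc (fun k => ((L j k : ℚ) : ℝ)) (fun k => ((H j k : ℚ) : ℝ)), W j θ) :
    ∀ θ ∈ Set.Icc (fun k => ((lo k : ℚ) : ℝ)) (fun k => ((hi k : ℚ) : ℝ)),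
      ∃ j, θ ∈ Set.Icc (fun k => ((L j k : ℚ) : ℝ)) (fun k => ((H j k : ℚ) : ℝ)) ∧ W j θ := by
  intro θ hθ
  obtain ⟨j, hj⟩ := exists_mem_Icc_of_kdCheck L H h θ hθ
  exact ⟨j, hj, hW j θ hj⟩

/-- **Certified constants, floor form.** Cell `j` carries `W θ (m j)` with a constant that may be
weakened downwards (`W θ m → m' ≤ m → W θ m'`: a certified lower bound); then the delivered box
carries `W θ m₀` for any `m₀` below every cell constant (take `m₀ = min_j m j`, checked by `decide` /
`norm_num`). [cite: Neumaier2004CompleteSearch, §12] -/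
theorem forall_mem_Icc_of_kdCheck_of_le {d : ℕ} {ι : Type} {β : Type*} [Preorder β]
    (L H : ι → Fin d → ℚ) {lo hi : Fin d → ℚ} {t : KdCert ι}
    (h : t.check (cellLeaf fun j => boxOfFn (L j) (H j)) (boxOfFn lo hi) = true)
    (W : (Fin d → ℝ) → β → Prop) (hmono : ∀ θ m m', W θ m → m' ≤ m → W θ m') (m : ι → β) {m₀ : β}
    (hm₀ : ∀ j, m₀ ≤ m j)
    (hW : ∀ j, ∀ θ ∈ Set.Icc (fun k => ((L j k : ℚ) : ℝ)) (fun k => ((H j k : ℚ) : ℝ)), W θ (m j)) :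
    ∀ θ ∈ Set.Icc (fun k => ((lo k : ℚ) : ℝ)) (fun k => ((hi k : ℚ) : ℝ)), W θ m₀ := by
  intro θ hθ
  obtain ⟨j, hj⟩ := exists_mem_Icc_of_kdCheck L H h θ hθ
  exact hmono θ (m j) m₀ (hW j θ hj) (hm₀ j)

/-- **Certified constants, ceiling form** (`W θ m → m ≤ m' → W θ m'`: a certified upper bound): the
delivered box carries any `m₀` above every cell constant. [cite: Neumaier2004CompleteSearch, §12] -/
theorem forall_mem_Icc_of_kdCheck_of_ge {d : ℕ} {ι : Type} {β : Type*} [Preorder β]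
    (L H : ι → Fin d → ℚ) {lo hi : Fin d → ℚ} {t : KdCert ι}
    (h : t.check (cellLeaf fun j => boxOfFn (L j) (H j)) (boxOfFn lo hi) = true)
    (W : (Fin d → ℝ) → β → Prop) (hmono : ∀ θ m m', W θ m → m ≤ m' → W θ m') (m : ι → β) {m₀ : β}
    (hm₀ : ∀ j, m j ≤ m₀)
    (hW : ∀ j, ∀ θ ∈ Set.Icc (fun k => ((L j k : ℚ) : ℝ)) (fun k => ((H j k : ℚ) : ℝ)), W θ (m j)) :
    ∀ θ ∈ Set.Icc (fun k => ((lo k : ℚ) : ℝ)) (fun k => ((hi k : ℚ) : ℝ)), W θ m₀ := by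
  intro θ hθ
  obtain ⟨j, hj⟩ := exists_mem_Icc_of_kdCheck L H h θ hθ
  exact hmono θ (m j) m₀ (hW j θ hj) (hm₀ j)

/-- **Two-sided windows.** Cell `j` carries a window `ℓ j ≤ e θ ≤ r j` of a real function `e`; the
delivered box carries `[ℓ₀, r₀]` for any `ℓ₀ ≤ ℓ j`, `r j ≤ r₀`. [cite: Neumaier2004CompleteSearch, §12] -/
theorem mem_Icc_of_kdCheck_window {d : ℕ} {ι : Type} (L H : ι → Fin d → ℚ) {lo hi : Fin d → ℚ}
    {t : KdCert ι}
    (h : t.check (cellLeaf fun j => boxOfFn (L j) (H j)) (boxOfFn lo hi) = true)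
    (e : (Fin d → ℝ) → ℝ) (ℓ r : ι → ℝ) {ℓ₀ r₀ : ℝ} (hℓ : ∀ j, ℓ₀ ≤ ℓ j) (hr : ∀ j, r j ≤ r₀)
    (hW : ∀ j, ∀ θ ∈ Set.Icc (fun k => ((L j k : ℚ) : ℝ)) (fun k => ((H j k : ℚ) : ℝ)),
      e θ ∈ Set.Icc (ℓ j) (r j)) :
    ∀ θ ∈ Set.Icc (fun k => ((lo k : ℚ) : ℝ)) (fun k => ((hi k : ℚ) : ℝ)), e θ ∈ Set.Icc ℓ₀ r₀ := by
  intro θ hθ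
  obtain ⟨j, hj⟩ := exists_mem_Icc_of_kdCheck L H h θ hθ
  exact ⟨(hℓ j).trans (hW j θ hj).1, (hW j θ hj).2.trans (hr j)⟩

/-- **Honest remainder.** The cells carry a tag `certified : ι → Bool`: the certified ones carry the
word `W`, the others are DECLARED GAPS (sub-boxes on which nothing is claimed — "undetermined: box not
covered"). If the certificate is accepted (the box lies in certified cells ∪ gaps), then at every point
of the delivered box either `W` holds or the point lies in one of the finitely many declared gap cells.
[cite: Neumaier2004CompleteSearch, §12] -/
theorem forall_mem_Icc_or_gap_of_kdCheck {d : ℕ} {ι : Type} (L H : ι → Fin d → ℚ)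
    {lo hi : Fin d → ℚ} {t : KdCert ι}
    (h : t.check (cellLeaf fun j => boxOfFn (L j) (H j)) (boxOfFn lo hi) = true)
    (certified : ι → Bool) {W : (Fin d → ℝ) → Prop}
    (hW : ∀ j, certified j = true →
      ∀ θ ∈ Set.Icc (fun k => ((L j k : ℚ) : ℝ)) (fun k => ((H j k : ℚ) : ℝ)), W θ) :
    ∀ θ ∈ Set.Icc (fun k => ((lo k : ℚ) : ℝ)) (fun k => ((hi k : ℚ) : ℝ)),
      W θ ∨ ∃ j, certified j = false ∧
        θ ∈ Set.Icc (fun k => ((L j k : ℚ) : ℝ)) (fun k => ((H j k : ℚ) : ℝ)) := by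
  intro θ hθ
  obtain ⟨j, hj⟩ := exists_mem_Icc_of_kdCheck L H h θ hθ
  cases hc : certified j
  · exact Or.inr ⟨j, hc, hj⟩
  · exact Or.inl (hW j hc θ hj)

/-! ### §4 Scalar letters: `(s, U)` rectangles and `(U, t', n)` boxes -/

/-- A pair of reals as a point of `Fin 2 → ℝ` lies in a box iff the four scalar inequalities hold.
[folklore] -/
private theorem vec₂_mem_Icc_iff (a b : Fin 2 → ℚ) (s u : ℝ) :
    (![s, u] : Fin 2 → ℝ) ∈ Set.Icc (fun k => ((a k : ℚ) : ℝ)) (fun k => ((b k : ℚ) : ℝ)) ↔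
      ((a 0 : ℚ) : ℝ) ≤ s ∧ s ≤ ((b 0 : ℚ) : ℝ) ∧ ((a 1 : ℚ) : ℝ) ≤ u ∧ u ≤ ((b 1 : ℚ) : ℝ) := by
  simp only [Set.mem_Icc, Pi.le_def, Fin.forall_fin_two, Matrix.cons_val_zero, Matrix.cons_val_one]
  tauto

/-- A triple of reals as a point of `Fin 3 → ℝ` lies in a box iff the six scalar inequalities hold.
[folklore] -/
private theorem vec₃_mem_Icc_iff (a b : Fin 3 → ℚ) (u s n : ℝ) :
    (![u, s, n] : Fin 3 → ℝ) ∈ Set.Icc (fun k => ((a k : ℚ) : ℝ)) (fun k => ((b k : ℚ) : ℝ)) ↔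
      ((a 0 : ℚ) : ℝ) ≤ u ∧ u ≤ ((b 0 : ℚ) : ℝ) ∧ ((a 1 : ℚ) : ℝ) ≤ s ∧ s ≤ ((b 1 : ℚ) : ℝ) ∧
        ((a 2 : ℚ) : ℝ) ≤ n ∧ n ≤ ((b 2 : ℚ) : ℝ) := by
  simp only [Set.mem_Icc, Pi.le_def, Fin.forall_fin_succ, Matrix.cons_val_zero,
    Matrix.cons_val_succ]
  constructor
  · rintro ⟨⟨h₁, h₂, h₃, -⟩, h₄, h₅, h₆, -⟩
    exact ⟨h₁, h₄, h₂, h₅, h₃, h₆⟩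
  · rintro ⟨h₁, h₄, h₂, h₅, h₃, h₆⟩
    exact ⟨⟨h₁, h₂, h₃, fun i => Fin.elim0 i⟩, h₄, h₅, h₆, fun i => Fin.elim0 i⟩

/-- **Two scalar coordinates** (e.g. `(s, U) = (t'/t, U/t)` at fixed filling): cell words in scalar
letters on rectangles `[L j 0, H j 0] × [L j 1, H j 1]` and an accepted certificate for the rectangle
`[lo 0, hi 0] × [lo 1, hi 1]` give the word at every point of that rectangle.
[cite: Neumaier2004CompleteSearch, §12] -/
theorem forall₂_of_kdCheck {ι : Type} (L H : ι → Fin 2 → ℚ) {lo hi : Fin 2 → ℚ} {t : KdCert ι}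
    (h : t.check (cellLeaf fun j => boxOfFn (L j) (H j)) (boxOfFn lo hi) = true)
    {W : ℝ → ℝ → Prop}
    (hW : ∀ j, ∀ s u : ℝ, ((L j 0 : ℚ) : ℝ) ≤ s → s ≤ ((H j 0 : ℚ) : ℝ) →
      ((L j 1 : ℚ) : ℝ) ≤ u → u ≤ ((H j 1 : ℚ) : ℝ) → W s u)
    {s u : ℝ} (hs₁ : ((lo 0 : ℚ) : ℝ) ≤ s) (hs₂ : s ≤ ((hi 0 : ℚ) : ℝ))
    (hu₁ : ((lo 1 : ℚ) : ℝ) ≤ u) (hu₂ : u ≤ ((hi 1 : ℚ) : ℝ)) : W s u := by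
  have hθ : (![s, u] : Fin 2 → ℝ) ∈
      Set.Icc (fun k => ((lo k : ℚ) : ℝ)) (fun k => ((hi k : ℚ) : ℝ)) :=
    (vec₂_mem_Icc_iff lo hi s u).2 ⟨hs₁, hs₂, hu₁, hu₂⟩
  obtain ⟨j, hj⟩ := exists_mem_Icc_of_kdCheck L H h _ hθ
  obtain ⟨h₁, h₂, h₃, h₄⟩ := (vec₂_mem_Icc_iff (L j) (H j) s u).1 hj
  exact hW j s u h₁ h₂ h₃ h₄

/-- **Three scalar coordinates in the order `(U/t, t'/t, n)`** (the delivered-box order of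
`HubbardTTPrimeBoxWordCovering` §3–§4 and of the S1/S2 seam): cell words in scalar letters on boxes
`[L j 0, H j 0] × [L j 1, H j 1] × [L j 2, H j 2]` and an accepted certificate give the word at every
point `(U, t', n)` of the delivered box. [cite: Neumaier2004CompleteSearch, §12] -/
theorem forall₃_of_kdCheck {ι : Type} (L H : ι → Fin 3 → ℚ) {lo hi : Fin 3 → ℚ} {t : KdCert ι}
    (h : t.check (cellLeaf fun j => boxOfFn (L j) (H j)) (boxOfFn lo hi) = true)
    {W : ℝ → ℝ → ℝ → Prop}
    (hW : ∀ j, ∀ u s n : ℝ, ((L j 0 : ℚ) : ℝ) ≤ u → u ≤ ((H j 0 : ℚ) : ℝ) →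
      ((L j 1 : ℚ) : ℝ) ≤ s → s ≤ ((H j 1 : ℚ) : ℝ) →
      ((L j 2 : ℚ) : ℝ) ≤ n → n ≤ ((H j 2 : ℚ) : ℝ) → W u s n)
    {u s n : ℝ} (hu₁ : ((lo 0 : ℚ) : ℝ) ≤ u) (hu₂ : u ≤ ((hi 0 : ℚ) : ℝ))
    (hs₁ : ((lo 1 : ℚ) : ℝ) ≤ s) (hs₂ : s ≤ ((hi 1 : ℚ) : ℝ))
    (hn₁ : ((lo 2 : ℚ) : ℝ) ≤ n) (hn₂ : n ≤ ((hi 2 : ℚ) : ℝ)) : W u s n := by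
  have hθ : (![u, s, n] : Fin 3 → ℝ) ∈
      Set.Icc (fun k => ((lo k : ℚ) : ℝ)) (fun k => ((hi k : ℚ) : ℝ)) :=
    (vec₃_mem_Icc_iff lo hi u s n).2 ⟨hu₁, hu₂, hs₁, hs₂, hn₁, hn₂⟩
  obtain ⟨j, hj⟩ := exists_mem_Icc_of_kdCheck L H h _ hθ
  obtain ⟨h₁, h₂, h₃, h₄, h₅, h₆⟩ := (vec₃_mem_Icc_iff (L j) (H j) u s n).1 hj
  exact hW j u s n h₁ h₂ h₃ h₄ h₅ h₆

end Literature.Computation.Certificates.BoxCovering
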